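import Summits.NavierStokesRegularity.FluidComputer.SuperLadder
import Summits.NavierStokesRegularity.NavierStokesRegularity.Theorems.FluidComputerCascade
import HarnessLib

/-!
# Fluid computer — the rungs above the amplitude end READ ON THE CELL'S INTERFACE (L53′, L54′ for cascade witnesses)

HONEST FRAMING (cell `pub-fluidc`, verbatim): *low prior, high value-of-information experiment on Tao's
machine paradigm; NOT a claim that NS blows up.* Theorem side of the cell; nothing here is evidence of blow-up.

Companion of `CascadeWitnessFloor`, `CascadeWitnessClock.time_face_of_cascadeWitness`,
`SobolevLadderFace.ladder_face_of_cascadeWitness` and `HomSobolevFace.homSobolev_face_of_cascadeWitness`: every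
`CascadeWitness` (bp3 interface) yields, via `x5a_of_cascadeWitness'`, a maximal smooth Leray–Hopf solution of the
unforced Navier–Stokes system on `ℝ³`, on which the dyadic-palinstrophy clock L53′
(`PalinstrophyClock.palinstrophy_clock`) and the super-ladder clock L54′ (`SuperLadder.superLadder_clock`, every
`σ > 3/2`) hold: `palinstrophy_clock_of_cascadeWitness`, `superLadder_clock_of_cascadeWitness`. 0 sorry; no new
definitions, no named facts.

## References

* J. Benameur, J. Math. Anal. Appl. 371 (2010) 719–727. [Benameur2010]
* J. Leray, Acta Math. 63 (1934), §19 (3.8)–(3.9) p. 224. [Leray1934]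
-/

noncomputable section

open MeasureTheory Set Function Filter Topology Metric
open scoped ENNReal NNReal
open Literature.Analysis.FluidPDE Literature.Analysis.FunctionSpaces
open Literature.Analysis.FluidPDE.FluidComputer
open Summit.NavierStokesRegularity.NavierStokesRegularity.Theorems.FluidComputer (x5a_of_cascadeWitness')
open Summit.NavierStokesRegularity.FluidComputer.PalinstrophyClock
open Summit.NavierStokesRegularity.FluidComputer.SuperLadder

namespace Summit.NavierStokesRegularity.FluidComputer.SuperLadderWitness

/-- **L53′ ON THE INTERFACE**: every `W : CascadeWitness` yields `ν > 0`, `T > 0` and a maximal smooth Leray–Hopf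
solution `(u, p)` with, for the constant `κ` of `palinstrophy_clock`:
`κ ν^{4/3} (T − t)^{−4/3} ≤ ‖u(0)‖₂^{2/3} ∑_j 2^{4j} ‖Δ̇_j u(t)‖₂²` at every `t ∈ (0, T)`.
[cite: Leray1934, §19 (3.8)–(3.9) p. 224] -/
theorem palinstrophy_clock_of_cascadeWitness (W : CascadeWitness) :
    ∃ ν : ℝ, 0 < ν ∧ ∃ T : ℝ, 0 < T ∧
      ∃ (u : ℝ → EuclideanSpace ℝ (Fin 3) → EuclideanSpace ℝ (Fin 3)) (p : ℝ → EuclideanSpace ℝ (Fin 3) → ℝ),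
        IsMaximalSmoothSolution ν 0 u p T ∧ IsLerayHopfOn T ν 0 (u 0) u ∧
        ∀ t ∈ Ioo 0 T,
          ENNReal.ofReal (palinstrophy_clock.choose * ν ^ (4 / 3 : ℝ) * (T - t) ^ (-(4 / 3 : ℝ))) ≤
            eLpNorm (u 0) 2 volume ^ (2 / 3 : ℝ) *
              ∑' j : ℤ, (2 : ℝ≥0∞) ^ ((4 : ℝ) * (j : ℝ)) * blockL2 (u t) j ^ 2 := by
  obtain ⟨ν, hν, T, hT, u, p, hmax, hLH, -⟩ := x5a_of_cascadeWitness' W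
  exact ⟨ν, hν, T, hT, u, p, hmax, hLH, palinstrophy_clock.choose_spec.2 ν T hν hT u p hmax hLH⟩

/-- **L54′ ON THE INTERFACE**: every `W : CascadeWitness` yields `ν > 0`, `T > 0` and a maximal smooth Leray–Hopf
solution `(u, p)` such that for EVERY `σ > 3/2`, with the constant `κ_σ` of `superLadder_clock`:
`κ_σ ν^{2σ/3} (T − t)^{−2σ/3} ≤ ‖u(0)‖₂^{(4σ−6)/3} ∑_j 4^{σj} ‖Δ̇_j u(t)‖₂²` at every `t ∈ (0, T)`.
[cite: Benameur2010, Thm. 1.1] -/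
theorem superLadder_clock_of_cascadeWitness (W : CascadeWitness) :
    ∃ ν : ℝ, 0 < ν ∧ ∃ T : ℝ, 0 < T ∧
      ∃ (u : ℝ → EuclideanSpace ℝ (Fin 3) → EuclideanSpace ℝ (Fin 3)) (p : ℝ → EuclideanSpace ℝ (Fin 3) → ℝ),
        IsMaximalSmoothSolution ν 0 u p T ∧ IsLerayHopfOn T ν 0 (u 0) u ∧
        ∀ σ : ℝ, ∀ hσ : 3 / 2 < σ, ∀ t ∈ Ioo 0 T,
          ENNReal.ofReal ((superLadder_clock σ hσ).choose * ν ^ (2 * σ / 3) * (T - t) ^ (-(2 * σ / 3))) ≤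
            eLpNorm (u 0) 2 volume ^ ((4 * σ - 6) / 3) *
              ∑' j : ℤ, (2 : ℝ≥0∞) ^ ((2 * σ) * (j : ℝ)) * blockL2 (u t) j ^ 2 := by
  obtain ⟨ν, hν, T, hT, u, p, hmax, hLH, -⟩ := x5a_of_cascadeWitness' W
  exact ⟨ν, hν, T, hT, u, p, hmax, hLH, fun σ hσ => (superLadder_clock σ hσ).choose_spec.2 ν T hν hT u p hmax hLH⟩

end Summit.NavierStokesRegularity.FluidComputer.SuperLadderWitness

end
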